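import Summits.RiemannHypothesis.RiemannHypothesis.Theorems.JensenPolynomialsFarGumbelJunkPointwiseR2

/-!
# Route `JensenPolynomials`, FAR crux `XiWindowZeroFreeRelFar` (B1-rel far) — line «far-gumbel» (theory g8, v5),
stub S2 `stub_junk`, part C: the singular integral and the region-R3 pointwise bound (RH-FREE; cell rh-jensen, HUMAN RULING D-0040; item
`stmt-RiemannHypothesis-19465`)

`‖I − J‖ ≤ farEnv`, i.e. `‖winI M s − winJ M υ (farA M s)‖ ≤ e^{L₀}‖1+z̃‖^{M−½}e^{−Λ/8}` for `M ≥ 2·10¹⁸`, the far mode `υ`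
(`4πe^{4υ}υ = 2M + 9υ`, `υ ≥ 189/20`) and `‖s‖ ≤ (7/20)M` (`z̃ = a/υ²`, `a = farA M s`). Assembly of parts A (split), B/B2
(pointwise region bounds) and the window law `c_M ≤ (1+1/4000)υ²` (`…ModeCM`): §1 the singular integral
`∫_A^B |u − u₀|^{−1/2}du ≤ 4√(B−A)`; §2 the three region integrals; §3 the envelope algebra and `stub_junk` by name.

WHAT THIS IS NOT: nothing here bears on the zeros of `ζ` or the truth of RH. References: [GORZPNAS2019]; theory g8's card
`far-gumbel` v5 (HOME rh-jensen-theory/g8/lines/).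
-/

noncomputable section
-- D-0017: `Summit.RiemannHypothesis.RiemannHypothesis.…` duplicates the namespace BY DESIGN (single-problem summit).
set_option linter.dupNamespace false

namespace Summit.RiemannHypothesis.RiemannHypothesis.Theorems.JensenPolynomials.FarGumbel

open Literature.NumberTheory.LFunctions MeasureTheory Set Complex Real
open Summit.RiemannHypothesis.RiemannHypothesis.Theorems.JensenPolynomials.WindowEGF

/-! ## 1. The singular integral `∫ |u − u₀|^{−1/2}` -/

/-- `|x|^{−1/2} = x^{−1/2} + (−x)^{−1/2}` for the real power (negative bases give `0` at exponent `−1/2`). -/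
theorem abs_rpow_neg_half (x : ℝ) : |x| ^ (-(1 / 2 : ℝ)) = x ^ (-(1 / 2 : ℝ)) + (-x) ^ (-(1 / 2 : ℝ)) := by
  have hcos : Real.cos (-(1 / 2 : ℝ) * π) = 0 := by
    rw [show -(1 / 2 : ℝ) * π = -(π / 2) by ring, Real.cos_neg, Real.cos_pi_div_two]
  rcases lt_trichotomy x 0 with hx | hx | hx
  · rw [abs_of_neg hx, Real.rpow_def_of_neg hx, hcos, mul_zero, zero_add]
  · subst hx; simp
  · have hnx : -x < 0 := by linarith
    rw [abs_of_pos hx, Real.rpow_def_of_neg hnx, hcos, mul_zero, add_zero]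

/-- `√b − √a ≤ √(b − a)` for `a ≤ b` (`√` of a negative number is `0`). -/
theorem sqrt_sub_sqrt_le {a b : ℝ} (hab : a ≤ b) : Real.sqrt b - Real.sqrt a ≤ Real.sqrt (b - a) := by
  rcases le_or_gt 0 a with ha | ha
  · have hba : 0 ≤ b - a := by linarith
    have hkey : b ≤ (Real.sqrt a + Real.sqrt (b - a)) ^ 2 := by
      nlinarith [Real.sq_sqrt ha, Real.sq_sqrt hba, Real.sqrt_nonneg a, Real.sqrt_nonneg (b - a)]
    have := Real.sqrt_le_sqrt hkey
    rw [Real.sqrt_sq (by positivity)] at this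
    linarith
  · rw [Real.sqrt_eq_zero'.mpr ha.le, sub_zero]
    exact Real.sqrt_le_sqrt (by linarith)

/-- **`∫_A^B |u − u₀|^{−1/2} du ≤ 4√(B − A)`**, with interval-integrability, for every `u₀` and `A ≤ B`. -/
theorem integral_abs_rpow_neg_half_le (u₀ : ℝ) {A B : ℝ} (hAB : A ≤ B) :
    IntervalIntegrable (fun u : ℝ ↦ |u - u₀| ^ (-(1 / 2 : ℝ))) volume A B ∧
      (∫ u in A..B, |u - u₀| ^ (-(1 / 2 : ℝ))) ≤ 4 * Real.sqrt (B - A) := by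
  have hr : (-1 : ℝ) < -(1 / 2 : ℝ) := by norm_num
  have h1 : IntervalIntegrable (fun u : ℝ ↦ (u - u₀) ^ (-(1 / 2 : ℝ))) volume A B := by
    have h := (intervalIntegral.intervalIntegrable_rpow' (a := A - u₀) (b := B - u₀) hr).comp_sub_right u₀
    simpa using h
  have h2 : IntervalIntegrable (fun u : ℝ ↦ (u₀ - u) ^ (-(1 / 2 : ℝ))) volume A B := by
    have h := (intervalIntegral.intervalIntegrable_rpow' (a := u₀ - A) (b := u₀ - B) hr).comp_sub_left u₀
    simpa using h
  have heq : (fun u : ℝ ↦ |u - u₀| ^ (-(1 / 2 : ℝ))) = fun u ↦ (u - u₀) ^ (-(1 / 2 : ℝ)) + (u₀ - u) ^ (-(1 / 2 : ℝ)) := by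
    ext u; rw [abs_rpow_neg_half, neg_sub]
  refine ⟨by rw [heq]; exact h1.add h2, ?_⟩
  rw [heq, intervalIntegral.integral_add h1 h2]
  have e1 : (∫ u in A..B, (u - u₀) ^ (-(1 / 2 : ℝ))) = 2 * ((B - u₀) ^ (1 / 2 : ℝ) - (A - u₀) ^ (1 / 2 : ℝ)) := by
    rw [intervalIntegral.integral_comp_sub_right (fun x ↦ x ^ (-(1 / 2 : ℝ))), integral_rpow (Or.inl hr)]
    norm_num; ring
  have e2 : (∫ u in A..B, (u₀ - u) ^ (-(1 / 2 : ℝ))) = 2 * ((u₀ - A) ^ (1 / 2 : ℝ) - (u₀ - B) ^ (1 / 2 : ℝ)) := by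
    rw [intervalIntegral.integral_comp_sub_left (fun x ↦ x ^ (-(1 / 2 : ℝ))), integral_rpow (Or.inl hr)]
    norm_num; ring
  rw [e1, e2]
  simp only [← Real.sqrt_eq_rpow]
  have hA1 := sqrt_sub_sqrt_le (show A - u₀ ≤ B - u₀ by linarith)
  have hA2 := sqrt_sub_sqrt_le (show u₀ - B ≤ u₀ - A by linarith)
  rw [show B - u₀ - (A - u₀) = B - A by ring] at hA1
  rw [show u₀ - A - (u₀ - B) = B - A by ring] at hA2
  linarith

/-! ## 2. Region R3 (`u > υ − 2`): pointwise bound for the truncation remainder -/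

/-- `Φ ≤ 0.45` everywhere (local copy of `…JunkPointwise`’s `deBruijnPhi_le_045`, kept private so that this file does not
import that module). -/
private theorem deBruijnPhi_le_045_loc (u : ℝ) : deBruijnPhi u ≤ 0.45 :=
  (deBruijnPhi_le_deBruijnPhi_zero u).trans deBruijnPhi_zero_le

/-- `u^{2M}‖1 + a/u²‖^{M−½} = u·‖u² + a‖^{M−½}` (`u > 0`). -/
theorem pow_mul_norm_one_add_rpow {M : ℕ} (hM : 1 ≤ M) {u : ℝ} (hu : 0 < u) (a : ℂ) :
    u ^ (2 * M) * ‖1 + a / (u : ℂ) ^ 2‖ ^ ((M : ℝ) - 1 / 2) = u * ‖(u : ℂ) ^ 2 + a‖ ^ ((M : ℝ) - 1 / 2) := by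
  have hu2 : 0 < u ^ 2 := by positivity
  have hfac : (u : ℂ) ^ 2 + a = (((u ^ 2 : ℝ)) : ℂ) * (1 + a / (u : ℂ) ^ 2) := by
    have hu0 : (u : ℂ) ≠ 0 := by exact_mod_cast hu.ne'
    push_cast; field_simp
  rw [hfac, norm_mul, Complex.norm_real, Real.norm_of_nonneg hu2.le, Real.mul_rpow hu2.le (norm_nonneg _),
    sq_rpow_halfExp hM hu.le]
  have : u ^ (2 * M) = u * u ^ (2 * M - 1) := by rw [← pow_succ']; congr 1; omega
  rw [this]; ring

set_option maxHeartbeats 400000 in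
/-- **R3 pointwise.** For `u > υ − 2` (`υ ≥ 189/20`), `‖a‖ ≤ 0.3502υ²`:
`Φu^{2M}‖T_M(a/u²) − (1+a/u²)^{M−½}‖ ≤ (0.5635^{M+1}/2)·Φ(u)u‖u²+a‖^{M−½} + 1.65‖a‖^{M+1}u^{−2}`. -/
theorem junk_pointwise_R3 {M : ℕ} (hM : 1 ≤ M) {υ u : ℝ} {a : ℂ} (hυ : (189 / 20 : ℝ) ≤ υ) (hu : υ - 2 < u)
    (ha : ‖a‖ ≤ 0.3502 * υ ^ 2) :
    deBruijnPhi u * u ^ (2 * M) *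
        ‖∑ k ∈ Finset.range (M + 1),
            ((((descPochhammer ℝ k).eval ((M : ℝ) - 1 / 2) / (Nat.factorial k : ℝ) : ℝ)) : ℂ) * (a / (u : ℂ) ^ 2) ^ k -
          (1 + a / (u : ℂ) ^ 2) ^ ((((M : ℝ) - 1 / 2 : ℝ)) : ℂ)‖ ≤
      0.5635 ^ (M + 1) / 2 * (deBruijnPhi u * u * ‖(u : ℂ) ^ 2 + a‖ ^ ((M : ℝ) - 1 / 2)) +
        1.65 * ‖a‖ ^ (M + 1) * u⁻¹ ^ 2 := by
  have hu0 : 0 < u := by linarith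
  have hu2 : 0 < u ^ 2 := by positivity
  have hΦ := deBruijnPhi_le_045_loc u
  have hΦ0 := (deBruijnPhi_pos_of_nonneg hu0.le).le
  have hC1 := halfBinom_top_le_one M
  have hC0 : 0 ≤ ((descPochhammer ℝ M).eval ((M : ℝ) - 1 / 2) / (Nat.factorial M : ℝ)) := (halfBinom_pos (le_refl M)).le
  set w : ℂ := a / (u : ℂ) ^ 2 with hwdef
  have hr : ‖w‖ = ‖a‖ / u ^ 2 := by rw [hwdef, norm_div, norm_pow, Complex.norm_real, Real.norm_of_nonneg hu0.le]
  -- `r ≤ 0.5635`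
  have hr1 : ‖w‖ ≤ 0.5635 := by
    rw [hr, div_le_iff₀ hu2]
    have h1 : 0.3502 * υ ^ 2 ≤ 0.5635 * (υ - 2) ^ 2 := by nlinarith
    have h2 : (υ - 2) ^ 2 ≤ u ^ 2 := by nlinarith
    nlinarith
  have hw1 : 1 + w ≠ 0 := by
    intro h
    have : w = -1 := by linear_combination h
    rw [this, norm_neg, norm_one] at hr1; norm_num at hr1
  -- the two-branch bound (part III form), `w = 0` trivial
  have hTB : ‖(∑ k ∈ Finset.range (M + 1), ((((descPochhammer ℝ k).eval ((M : ℝ) - 1 / 2) / (Nat.factorial k : ℝ)) : ℝ) : ℂ) * w ^ k) -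
      (1 + w) ^ ((((M : ℝ) - 1 / 2) : ℝ) : ℂ)‖ ≤
      ‖1 + w‖ ^ (((M : ℝ) - 1 / 2)) * (((descPochhammer ℝ M).eval ((M : ℝ) - 1 / 2) / (Nat.factorial M : ℝ)) * ‖w‖ ^ (M + 1) / (2 * (M + 1))) +
        ((descPochhammer ℝ M).eval ((M : ℝ) - 1 / 2) / (Nat.factorial M : ℝ)) / 2 * ‖w‖ ^ (M + 1) *
          ∫ β in (0 : ℝ)..|arg w|, ‖1 + ((‖w‖ : ℂ) * Complex.exp ((β : ℂ) * I))‖⁻¹ := by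
    by_cases hw0 : w = 0
    · rw [hw0]
      have hT := truncBinom_zero M
      rw [hT]; simp
    · exact norm_truncBinom_sub_cpow_le M hM hw0 hw1
  -- the arc integral ≤ 7.2
  have hJ : (∫ β in (0 : ℝ)..|arg w|, ‖1 + ((‖w‖ : ℂ) * Complex.exp ((β : ℂ) * I))‖⁻¹) ≤ 7.3 := by
    have hne1 : ‖w‖ ≠ 1 := by intro h; rw [h] at hr1; norm_num at hr1
    have h := arcInv_integral_le_div ‖w‖ |arg w| (norm_nonneg _) hne1 (abs_nonneg _)
    refine h.trans ?_
    have hden : |1 - ‖w‖| = 1 - ‖w‖ := abs_of_pos (by linarith)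
    rw [hden, div_le_iff₀ (by linarith)]
    have h1 := Complex.abs_arg_le_pi w
    have h2 := pi_lt_d2
    nlinarith [h1, h2, hr1]
  have hI0 : 0 ≤ ∫ β in (0 : ℝ)..|arg w|, ‖1 + ((‖w‖ : ℂ) * Complex.exp ((β : ℂ) * I))‖⁻¹ :=
    intervalIntegral.integral_nonneg (abs_nonneg _) fun β _ ↦ inv_nonneg.mpr (norm_nonneg _)
  -- `u^{2M} ‖w‖^{M+1} = ‖a‖^{M+1} u^{-2}`
  have hrM : u ^ (2 * M) * ‖w‖ ^ (M + 1) = ‖a‖ ^ (M + 1) * u⁻¹ ^ 2 := by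
    rw [hr, div_pow, inv_pow, pow_succ ‖a‖, pow_mul]
    have hune : (u ^ 2) ^ M ≠ 0 := pow_ne_zero _ hu2.ne'
    field_simp
    ring
  have hbulk := pow_mul_norm_one_add_rpow hM hu0 a
  rw [← hwdef] at hbulk
  -- term 1
  have hq : ((descPochhammer ℝ M).eval ((M : ℝ) - 1 / 2) / (Nat.factorial M : ℝ)) * ‖w‖ ^ (M + 1) / (2 * (M + 1)) ≤
      0.5635 ^ (M + 1) / 2 := by
    rw [div_le_div_iff₀ (by positivity) (by norm_num)]
    have h1 : ‖w‖ ^ (M + 1) ≤ 0.5635 ^ (M + 1) := pow_le_pow_left₀ (norm_nonneg _) hr1 _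
    have h2 : ((descPochhammer ℝ M).eval ((M : ℝ) - 1 / 2) / (Nat.factorial M : ℝ)) * ‖w‖ ^ (M + 1) ≤ 1 * 0.5635 ^ (M + 1) :=
      mul_le_mul hC1 h1 (by positivity) (by norm_num)
    have hM0 : (0 : ℝ) ≤ M := by positivity
    nlinarith [h2, pow_nonneg (by norm_num : (0:ℝ) ≤ 0.5635) (M + 1), hM0]
  have T1 : u ^ (2 * M) * (‖1 + w‖ ^ (((M : ℝ) - 1 / 2)) *
      (((descPochhammer ℝ M).eval ((M : ℝ) - 1 / 2) / (Nat.factorial M : ℝ)) * ‖w‖ ^ (M + 1) / (2 * (M + 1)))) ≤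
      0.5635 ^ (M + 1) / 2 * (u * ‖(u : ℂ) ^ 2 + a‖ ^ ((M : ℝ) - 1 / 2)) := by
    calc u ^ (2 * M) * (‖1 + w‖ ^ (((M : ℝ) - 1 / 2)) *
          (((descPochhammer ℝ M).eval ((M : ℝ) - 1 / 2) / (Nat.factorial M : ℝ)) * ‖w‖ ^ (M + 1) / (2 * (M + 1))))
        = (u ^ (2 * M) * ‖1 + w‖ ^ (((M : ℝ) - 1 / 2))) *
          (((descPochhammer ℝ M).eval ((M : ℝ) - 1 / 2) / (Nat.factorial M : ℝ)) * ‖w‖ ^ (M + 1) / (2 * (M + 1))) := by ring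
      _ ≤ (u * ‖(u : ℂ) ^ 2 + a‖ ^ ((M : ℝ) - 1 / 2)) * (0.5635 ^ (M + 1) / 2) := by
          rw [hbulk]; exact mul_le_mul_of_nonneg_left hq (by positivity)
      _ = _ := by ring
  -- term 2
  have T2 : u ^ (2 * M) * (((descPochhammer ℝ M).eval ((M : ℝ) - 1 / 2) / (Nat.factorial M : ℝ)) / 2 * ‖w‖ ^ (M + 1) *
      ∫ β in (0 : ℝ)..|arg w|, ‖1 + ((‖w‖ : ℂ) * Complex.exp ((β : ℂ) * I))‖⁻¹) ≤ 3.65 * (‖a‖ ^ (M + 1) * u⁻¹ ^ 2) := by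
    calc u ^ (2 * M) * (((descPochhammer ℝ M).eval ((M : ℝ) - 1 / 2) / (Nat.factorial M : ℝ)) / 2 * ‖w‖ ^ (M + 1) *
          ∫ β in (0 : ℝ)..|arg w|, ‖1 + ((‖w‖ : ℂ) * Complex.exp ((β : ℂ) * I))‖⁻¹)
        = (((descPochhammer ℝ M).eval ((M : ℝ) - 1 / 2) / (Nat.factorial M : ℝ)) / 2) * (u ^ (2 * M) * ‖w‖ ^ (M + 1)) *
          ∫ β in (0 : ℝ)..|arg w|, ‖1 + ((‖w‖ : ℂ) * Complex.exp ((β : ℂ) * I))‖⁻¹ := by ring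
      _ ≤ (1 / 2) * (‖a‖ ^ (M + 1) * u⁻¹ ^ 2) * 7.3 := by
          rw [hrM]
          exact mul_le_mul (mul_le_mul_of_nonneg_right (by linarith) (by positivity)) hJ hI0 (by positivity)
      _ = 3.65 * (‖a‖ ^ (M + 1) * u⁻¹ ^ 2) := by ring
  -- combine with Φ ≤ 0.45
  have hmain := mul_le_mul_of_nonneg_left hTB (mul_nonneg hΦ0 (pow_nonneg hu0.le (2 * M)))
  have hΦT1 : deBruijnPhi u * (u ^ (2 * M) * (‖1 + w‖ ^ (((M : ℝ) - 1 / 2)) *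
      (((descPochhammer ℝ M).eval ((M : ℝ) - 1 / 2) / (Nat.factorial M : ℝ)) * ‖w‖ ^ (M + 1) / (2 * (M + 1))))) ≤
      deBruijnPhi u * (0.5635 ^ (M + 1) / 2 * (u * ‖(u : ℂ) ^ 2 + a‖ ^ ((M : ℝ) - 1 / 2))) :=
    mul_le_mul_of_nonneg_left T1 hΦ0
  have hΦT2 : deBruijnPhi u * (u ^ (2 * M) * (((descPochhammer ℝ M).eval ((M : ℝ) - 1 / 2) / (Nat.factorial M : ℝ)) / 2 *
      ‖w‖ ^ (M + 1) * ∫ β in (0 : ℝ)..|arg w|, ‖1 + ((‖w‖ : ℂ) * Complex.exp ((β : ℂ) * I))‖⁻¹)) ≤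
      0.45 * (3.65 * (‖a‖ ^ (M + 1) * u⁻¹ ^ 2)) :=
    mul_le_mul hΦ T2 (by positivity) (by norm_num)
  have e1 : deBruijnPhi u * u ^ (2 * M) *
      (‖1 + w‖ ^ (((M : ℝ) - 1 / 2)) * (((descPochhammer ℝ M).eval ((M : ℝ) - 1 / 2) / (Nat.factorial M : ℝ)) * ‖w‖ ^ (M + 1) / (2 * (M + 1))) +
        ((descPochhammer ℝ M).eval ((M : ℝ) - 1 / 2) / (Nat.factorial M : ℝ)) / 2 * ‖w‖ ^ (M + 1) *
          ∫ β in (0 : ℝ)..|arg w|, ‖1 + ((‖w‖ : ℂ) * Complex.exp ((β : ℂ) * I))‖⁻¹) =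
      deBruijnPhi u * (u ^ (2 * M) * (‖1 + w‖ ^ (((M : ℝ) - 1 / 2)) *
        (((descPochhammer ℝ M).eval ((M : ℝ) - 1 / 2) / (Nat.factorial M : ℝ)) * ‖w‖ ^ (M + 1) / (2 * (M + 1))))) +
      deBruijnPhi u * (u ^ (2 * M) * (((descPochhammer ℝ M).eval ((M : ℝ) - 1 / 2) / (Nat.factorial M : ℝ)) / 2 *
        ‖w‖ ^ (M + 1) * ∫ β in (0 : ℝ)..|arg w|, ‖1 + ((‖w‖ : ℂ) * Complex.exp ((β : ℂ) * I))‖⁻¹)) := by ring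
  have e2 : deBruijnPhi u * (0.5635 ^ (M + 1) / 2 * (u * ‖(u : ℂ) ^ 2 + a‖ ^ ((M : ℝ) - 1 / 2))) =
      0.5635 ^ (M + 1) / 2 * (deBruijnPhi u * u * ‖(u : ℂ) ^ 2 + a‖ ^ ((M : ℝ) - 1 / 2)) := by ring
  have hpos : 0 ≤ ‖a‖ ^ (M + 1) * u⁻¹ ^ 2 := by positivity
  linarith [hmain, hΦT1, hΦT2, e1, e2, hpos]

end Summit.RiemannHypothesis.RiemannHypothesis.Theorems.JensenPolynomials.FarGumbel
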